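import Summits.RiemannHypothesis.RiemannHypothesis.Theorems.ThetaTier2RowSound
import Summits.RiemannHypothesis.RiemannHypothesis.Theorems.WeilColumnThetaWitness
import HarnessLib

/-!
# THETA tier-2 — the ARCH coefficient of a row against `Jexplicit` (bridge helper for `T2Matches.cA_ge`; cc-s2-1; RH-FREE)

`Row2.real.cA = max 0 (2·J⁺ − log 4π − γ⁻ − (π/2 + log 2))` with `J⁺ = Row2.JR` = the register-32 form of `Jexplicit (2^{-k})` and the
stand-in `γ⁻ = GAMMA_LO = 1/2 ≤ γ` (Mathlib `Real.one_half_lt_eulerMascheroniConstant`).  Hence the `T2Matches` field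
`cA_ge : max 0 (2·Jexplicit t₀ − log 4π − γ − archC₁) ≤ X.cA` for `X = r.real`, `t₀ = r.real.t0 = 2^{-k}`:
`JR_eq_Jexplicit`, `real_cA_ge`.  Nothing here bears on the truth of RH.
-/

set_option linter.dupNamespace false  -- the mandated namespace repeats `RiemannHypothesis`
set_option autoImplicit false

namespace Summit.RiemannHypothesis.RiemannHypothesis.Theorems.ThetaTier2

open ThetaTier1 (GAMMA_LO)
open Summit.RiemannHypothesis.RiemannHypothesis.Theorems.WeilColumn.ThetaMellin
open Real

namespace Row2

variable (r : Row2)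

/-- **`J⁺ = Jexplicit (2^{-k})`.** [this cell, THETA-CERT-cc6 D7] -/
theorem JR_eq_Jexplicit : r.JR = ThetaParams.Jexplicit r.real.t0 := by
  show r.JR = ThetaParams.Jexplicit (((r.t0 : ℚ)) : ℝ)
  have ht : (((r.t0 : ℚ)) : ℝ) = 1 / (2 : ℝ) ^ r.k := by unfold t0; push_cast; ring
  have hl : Real.log (1 / (1 / (2 : ℝ) ^ r.k)) = r.k * Real.log 2 := by rw [one_div_one_div, Real.log_pow]
  rw [ht]
  simp only [ThetaParams.Jexplicit, hl, JR]
  have hne : (1 : ℝ) - Real.exp (-2) ≠ 0 := by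
    have : Real.exp (-2) < 1 := Real.exp_lt_one_iff.2 (by norm_num)
    linarith
  push_cast
  field_simp
  ring

/-- **`T2Matches.cA_ge` for `X = r.real`**: `max 0 (2·Jexplicit t₀ − log 4π − γ − archC₁) ≤ r.real.cA` (`γ ≥ 1/2`). [this cell, THETA-CERT-cc6 D7] -/
theorem real_cA_ge : max 0 (2 * ThetaParams.Jexplicit r.real.t0 - Real.log (4 * π) - Real.eulerMascheroniConstant - ThetaParams.archC₁)
    ≤ r.real.cA := by
  show _ ≤ max 0 (2 * r.JR - Real.log (4 * Real.pi) - ((GAMMA_LO : ℚ) : ℝ) - (Real.pi * (1 / 2) + Real.log 2))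
  rw [JR_eq_Jexplicit]
  have hγ := Real.one_half_lt_eulerMascheroniConstant
  have hG : ((GAMMA_LO : ℚ) : ℝ) = 1 / 2 := by unfold ThetaTier1.GAMMA_LO; push_cast; norm_num
  rw [hG]
  refine max_le_max le_rfl ?_
  simp only [ThetaParams.archC₁]
  linarith

end Row2

end Summit.RiemannHypothesis.RiemannHypothesis.Theorems.ThetaTier2
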